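import Literature.Probability.LatticeModels.GlauberCovarianceDecay
import Literature.Probability.LatticeModels.GlauberStrongMixingUniqueness
import Literature.Probability.LatticeModels.GlauberDynamicsLogSobolevBounds
import HarnessLib

/-!
# Uniform logarithmic Sobolev constant ⇒ strong mixing on cubes and a unique Gibbs measure
# ([Mar99] Theorem 3.3 (b)–(c)), DISCHARGED

Topic `Literature/Probability/LatticeModels`; the assembly step of the discharge of the named fact
`Glauber.Martinelli1999_thm3_3` of `GlauberDynamicsStrongMixing.lean` (cell `ym-ir`, seat lit-3, census rows
B2/B4): `theorem Glauber.Martinelli1999_thm3_3_holds : Martinelli1999_thm3_3 U`, no new named fact (D-0026).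
SIBLING-SETTING result (finite-range interactions, `±1` spins on `ℤ^d`); nothing here is a statement about gauge
theories, and the Yang–Mills mass gap is not touched by it.

Source (held; `book:bertoin1999-lectures-probability-theory-statistics`): [Mar99] F. Martinelli, *Lectures on
Glauber dynamics for discrete spin models*, LNM 1717 (1999), Theorem 3.3 p0170 L29–41 (hypothesis
`sup_L sup_τ c_s(L_{B_L}^τ) < ∞`; (b) `SMT(B_L, l₀, α)` for all `L`; (c) «there exists a unique Gibbs measure»),
its proof p0171–p0172 and the Remark p0172 L40 – p0173 L3; the «well known result `gap(L_V^τ) ≥ c_s(L_V^τ)⁻¹`»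
p0171 L31–33. [cite: Martinelli1999, Theorem 3.3]

Proof (three tree theorems): a uniform log-Sobolev constant `c` gives the uniform gap `(max c 1)⁻¹`
(`Glauber.LogSobolevIneq.poincareIneq`, `GlauberDynamicsLogSobolevBounds.lean`); the uniform gap gives (b)
(`Glauber.Martinelli1999_SMT_of_uniformGap_holds`, `GlauberCovarianceDecay.lean` — [Mar99]'s Remark); (b) gives
(c) (`Glauber.hasUniqueGibbsMeasure_of_SMT`, `GlauberStrongMixingUniqueness.lean` — boundary flips as tilts,
Theorem 2.7 (ii) ⇒ (i), DLR transfer, existence by compactness).  As recorded in the typing, part (a) (uniform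
exponential ergodicity of the semigroups in sup norm) is not part of the typed fact.
-/

noncomputable section

namespace Literature.Probability.LatticeModels

namespace Glauber

variable {d r : ℕ}

/-- **[Mar99] Theorem 3.3 (b)–(c) — DISCHARGED**: if `sup_L sup_τ c_s(μ_{B_L}^τ) < ∞` (a uniform logarithmic
Sobolev inequality for the heat-bath Dirichlet form `½ μ(|∇ f|²)` on all cubes and all boundary conditions), then
(b) there are `α, l₀ > 0` with `SMT(B_L, l₀, α)` for all `L`, and (c) there is exactly one Gibbs measure.
Closes the named fact `Glauber.Martinelli1999_thm3_3` (the binder `U` is the fact's own parameter).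
[cite: Martinelli1999, Theorem 3.3] -/
theorem Martinelli1999_thm3_3_holds (U : FRPotential d ℤˣ r) : Martinelli1999_thm3_3 U := by
  intro β hLS
  obtain ⟨c, hc⟩ := hLS
  have hγ := U.isSpecification_spec β
  have hgap : ∃ g : ℝ, 0 < g ∧ ∀ (L : ℕ) (τ : Site d → ℤˣ),
      PoincareIneq (U.spec β (centeredCube d L) τ) (centeredCube d L) g := by
    refine ⟨(max c 1)⁻¹, by positivity, fun L τ => ?_⟩
    haveI := hγ.isProbability (centeredCube d L) τ
    exact ((hc L τ).mono (le_max_left c 1)).poincareIneq (lt_of_lt_of_le one_pos (le_max_right c 1))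
  obtain ⟨α, l₀, hα, hl₀, hSMT⟩ := Martinelli1999_SMT_of_uniformGap_holds U β hgap
  exact ⟨⟨α, l₀, hα, hl₀, hSMT⟩, hasUniqueGibbsMeasure_of_SMT U β hα fun L _ => hSMT L⟩

end Glauber

end Literature.Probability.LatticeModels

end
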